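import Summits.BirchSwinnertonDyer.BirchSwinnertonDyer.Theorems.SignedBaseChangeAuxiliaryCurves
import Summits.BirchSwinnertonDyer.BirchSwinnertonDyer.Theorems.SignedBaseChangeEisensteinSqueeze
import Summits.BirchSwinnertonDyer.BirchSwinnertonDyer.Theorems.SignedBaseChangeK2RDivisibilityDescent
import Summits.BirchSwinnertonDyer.BirchSwinnertonDyer.Theorems.SignedBaseChangeTwistPairGreenbergProductDivisibilityStubFrameData
import Literature.NumberTheory.EllipticCurves.BurungaleSkinnerTianWan2024.SignedTwoVariableDescentPackagePRE
import Literature.NumberTheory.EllipticCurves.CyclotomicIwasawaMainTheoremIrreducibleProofs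
import Literature.NumberTheory.QuadraticFields.KroneckerSplitting
import HarnessLib

/-!
# K2R‴ `SignedLowerDescentFromCommonFrame` (stmt-BirchSwinnertonDyer-20213), stub (S3) `stub_transferDescent`
# — the s-free Greenberg → signed transfer and descent for the twist pair, PROVED from the typed BSTW
# package binder `props118_27_519_exists_signedTwoVariablePackage_supersingular_PRE` (taken BY NAME)

Route-independent `Theorems` file of the cell `bsd-wall`, seat `bsd-wall-sbc-p2` (prover; crux skeleton v6).

Registered stub (S3) says: for the K1′ package data of route `SignedBaseChange`, a genuine common Katz frame
`(Ω ≠ 0, δ, Ω_p, L_K)` carrying Greenberg functions `G` of `f = f_W` and `G'` of `f' = f_{W'}`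
(`W' ≅ W^{(d)}`), a structure map `J`, and the s-FREE product inclusion
`ch(X_Gr(W/K̃_∞))·ch(X_Gr(W'/K̃_∞)) ⊆ (G·G')` in `𝒪_{ℂ_p}⟦T₂⟧⟦T₁⟧`, the f-normalised four-curve signed lower
divisibility over `ℚ_∞` holds: `L^ε(f)L^ε(f₂)L^ε(f′)L^ε(f₄) ∣ g₁g₂g₃g₄` in `ℤ_p⟦T⟧` for Kobayashi's `L^ε`
(Pollack pairs) and characteristic generators of `X^ε` of `W, W₂ ≃ W^{(D_K)}, W', W₄ ≃ W'^{(D_K)}`.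

The typer file `Literature/…/BurungaleSkinnerTianWan2024/SignedTwoVariableDescentPackagePRE.lean`
(seat `bsd-wall-ty-1`, p528812) typed the printed inputs of BSTW arXiv:2409.01350v2 — Prop. 1.18 (identity
form), Prop. 2.7 ("in particular"), Prop. 5.19 + (sspLcy) + the [Ko]/[Po] dictionary — as ONE claim-tagged
PRE binder, EXISTENTIAL over the two untyped carriers `ξ_∘ = ξ(X_∘(g/L))`, `𝓛^∘ = 𝓛_p^∘(g/L)`, and
proved the three ring identities a consumer needs (§2 there). THIS FILE IS THE CONSUMER: it proves

* `productLowerDivisibility_of_package` — (S3) from the binder BY NAME, for the frame's own newforms `f`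
  (level `N = N_W`) and `f'` (level `N' = N_{W'}`) and ANY newforms `f₂`, `f₄` of `W₂`, `W₄` — with ONE
  extra hypothesis the binder's coordinate clause needs and the package does not (yet) carry: **«`γ₁`
  canonical»** — `χ_cyc,K(γ₁) ∈ (1 + p)·μ` (`∃ ζ` of finite order with `χ_cyc,K(γ₁)·ζ = cyclotomicGenerator p`,
  the `K`-twin of the tree's `IsCyclotomicVariable`), under which every canonical `ℚ`-cyclotomic datum
  `(κ, γ)` matches `γ₁` modulo torsion (typer finding (c) / reading flag `BSTW-2VS-coords`; the route author
  adds it to K1′'s `∃`-package at the next restate, or a two-variable generator-change transport is owed).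

Assembly (BSTW §2.3, proof of Thm. (KoMC_r), run for a PAIR with only the PRODUCT Greenberg inclusion):
package at `(f, G)` and at `(f', G')` ⇒ `(ξ_∘ G) = ch·(𝓛^∘)`, `(ξ'_∘ G') = ch'·(𝓛'^∘)` (P1 ×2); `G·G' ≠ 0`
(else `𝓛^∘ = 0` on the cyclotomic line against Pollack's `L^ε ≠ 0`, or a characteristic ideal would
vanish); cancel (`mul_dvd_mul_of_span_mul_eq_of_le_span`): `𝓛^∘𝓛'^∘ ∣ ξ_∘ξ'_∘`; descend through
`UnrSeries₂.plus` = "mod `(γ_ac − 1)`" with (P2)/(P3) (`mul_dvd_mul_of_map_of_dvd_of_eq_unit_mul`):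
`J(L₁L₂)·J(L₃L₄) ∣ J(g₁g₂)·J(g₃g₄)` in `𝒪_{ℂ_p}⟦T⟧`; descend to `ℤ_p⟦T⟧`
(`…K2RDivisibilityDescent.iwasawaAlgebra_dvd_of_map_dvd_map_padicComplexInt`, p530884). Side conditions
of the binder at `f'`: good supersingular reduction and `Surj` of the twist (`…AuxiliaryCurves`), (irr_K)
framed for `W'` (`…SignedBaseChangeK1FrameData.irrK_framed_of_surj`), `(N', D_K) = 1` (§1 below).

HONEST SCOPE: CONDITIONAL on the PRE binder (unrefereed preprint content, claim-tagged, never a theorem)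
and on «`γ₁` canonical»; `f`, `f'` at conductor level (the registered (S3) quantifies over newforms of any
level — the consumer K2R‴ only needs the conductor-level newform of `W`, see `…EisensteinSqueeze`).

References: [BurungaleSkinnerTianWan2024] arXiv:2409.01350v2 Prop. 1.18, Prop. 2.7, Prop. 5.19, §2.3
(corpus paper:arxiv-2409.01350 p0072, p0076, p0054–55); [Kobayashi2003] Thm. 3.2, (3.4)–(3.6); [Pollack2003]
Cor. 5.11; tree: `SignedTwoVariableDescentPackagePRE.lean` (binder + §2 algebra), K1′ stmt-20502 (frame
currency), crux skeleton v6 of stmt-20213 (HOME bsd-wall-sbc-p2/).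
-/

set_option autoImplicit false

noncomputable section

open scoped Classical

open CongruenceSubgroup WeierstrassCurve NumberField IsDedekindDomain Field
  Literature.NumberTheory.GaloisRepresentations Literature.NumberTheory.EllipticCurves
  Literature.NumberTheory.EllipticCurves.ModularForms Literature.NumberTheory.EllipticCurves.Rank1Residual
  Literature.NumberTheory.EllipticCurves.BurungaleSkinnerTianWan2024
  Literature.NumberTheory.EllipticCurves.Kobayashi2003
  Summit.BirchSwinnertonDyer.Rank1Residual.Supersingular

namespace Summit.BirchSwinnertonDyer.BirchSwinnertonDyer.Theorems.SignedBaseChangeK2RTransferDescent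

variable {p : ℕ} [Fact p.Prime]

/-! ## §1. Side conditions of the binder at the twist `W'` -/

/-- **`(N', D_K) = 1` for the admissible twist.** A prime `q ∣ N'` with `q ∣ D_K`: if `q` ramifies in
`ℚ(√d)` the admissibility clause gives `q ∤ D_K`; `q = 2` cannot divide `D_K` since `2` splits in `K`
(`D_K ≡ 1 (mod 8)`); otherwise `q ∤ 2d`, so `q` is a bad prime of `W` (good reduction passes to the twist,
`Supersingular.hasGoodReductionAtPrime_of_smul_eq_quadraticTwist`), contradicting `(N, D_K) = 1`.
[cite: SilvermanAEC2009, VII.5 Prop. 5.1(a)] -/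
theorem isCoprime_conductorNorm_twist_discr (W W' : WeierstrassCurve ℚ) [W.IsElliptic] [W.IsGloballyMinimal]
    [W'.IsElliptic] [W'.IsGloballyMinimal] {d : ℤ} {C : VariableChange ℚ}
    (hC : C • W' = W.quadraticTwist (d : ℚ)) {N N' : ℕ} (hN : (N : ℤ) = W.conductorNorm ℤ)
    (hN' : (N' : ℤ) = W'.conductorNorm ℤ) (K : Type) [Field K] [NumberField K] (hK2 : Module.finrank ℚ K = 2)
    (hram : ∀ q : ℕ, q.Prime → RamifiedInQuadratic d q → ¬ (q : ℤ) ∣ NumberField.discr K)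
    (hsplit2 : ((Ideal.span {(2 : ℤ)}).primesOver (𝓞 K)).ncard = 2)
    (hND : IsCoprime (N : ℤ) (NumberField.discr K)) : IsCoprime (N' : ℤ) (NumberField.discr K) := by
  have hNn : N = W.conductorNorm ℤ := by exact_mod_cast hN
  have hN'n : N' = W'.conductorNorm ℤ := by exact_mod_cast hN'
  rw [Int.isCoprime_iff_gcd_eq_one, Int.gcd_eq_natAbs, Int.natAbs_natCast]
  refine Nat.coprime_of_dvd fun q hq hqN' hqD ↦ ?_
  haveI : Fact q.Prime := ⟨hq⟩
  have hqD' : (q : ℤ) ∣ NumberField.discr K := Int.ofNat_dvd_left.mpr hqD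
  by_cases hr : RamifiedInQuadratic d q
  · exact hram q hq hr hqD'
  · have hqd : ¬ (q : ℤ) ∣ d := fun h ↦ hr (Or.inl h)
    rcases eq_or_ne q 2 with rfl | hq2
    · have h8 : NumberField.discr K % 8 = 1 :=
        (Literature.NumberTheory.QuadraticFields.Quadratic.ncard_primesOver_two_eq_two_iff hK2).mp hsplit2
      omega
    · have hq2d : ¬ (q : ℤ) ∣ 2 * d := by
        intro h
        rcases (Nat.prime_iff_prime_int.mp hq).dvd_or_dvd h with h' | h'
        · have : q ∣ 2 := by exact_mod_cast h'
          exact hq2 ((Nat.prime_dvd_prime_iff_eq hq Nat.prime_two).mp this)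
        · exact hqd h'
      have hbad : ¬ W'.HasGoodReductionAtPrime q :=
        (W'.dvd_conductorNorm_iff_not_hasGoodReductionAtPrime q).mp (hN'n ▸ hqN')
      have hbadW : ¬ W.HasGoodReductionAtPrime q := fun hg ↦
        hbad (hasGoodReductionAtPrime_of_smul_eq_quadraticTwist W W' q hC hq2d hg)
      have hqN : (q : ℤ) ∣ (N : ℤ) := by
        rw [hNn]
        exact Int.natCast_dvd_natCast.mpr ((W.dvd_conductorNorm_iff_not_hasGoodReductionAtPrime q).mpr hbadW)
      have hu := hND.isUnit_of_dvd' hqN hqD'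
      rw [Int.isUnit_iff_natAbs_eq, Int.natAbs_natCast] at hu
      exact hq.one_lt.ne' hu

/-! ## §2. Bookkeeping: non-vanishing of the Greenberg functions, the coordinate clause -/

/-- The extension of a two-variable characteristic ideal along an injective `toUnr₂ J` is non-zero
(`Module.charIdeal` is never `⊥` over a domain). [folklore] -/
theorem map_charIdealXGr₂_ne_bot {K : Type} [Field K] [NumberField K] (W : WeierstrassCurve K)
    (κ₁ κ₂ : ZpExtension K p) (vbar : HeightOneSpectrum (𝓞 K)) (γ₁ γ₂ : absoluteGaloisGroup K)
    [Fact (ZpExtension.IsTopGeneratorPair κ₁ κ₂ γ₁ γ₂)] {J : ℤ_[p] →+* PadicComplexInt p}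
    (hJ : Function.Injective J) :
    (WeierstrassCurve.XGr₂.charIdeal W p κ₁ κ₂ vbar γ₁ γ₂).map (IwasawaAlgebra₂.toUnr₂ p J) ≠ ⊥ := by
  have hinj : Function.Injective (IwasawaAlgebra₂.toUnr₂ p J) :=
    PowerSeries.map_injective _ (PowerSeries.map_injective _ hJ)
  intro h
  rw [Ideal.map_eq_bot_iff_le_ker, (RingHom.injective_iff_ker_eq_bot _).mp hinj, le_bot_iff] at h
  exact Module.charIdeal_ne_bot (IwasawaAlgebra₂ p) _ h

/-- From (P1) `(ξ·G) = I·(𝓛)` with `I ≠ ⊥` and `𝓛 ≠ 0`: `G ≠ 0`. [cite: BurungaleSkinnerTianWan2024, Prop. 1.18 (arXiv v2 TeX store p0072 L14–L17) — bookkeeping] -/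
theorem ne_zero_of_span_mul_eq {R : Type*} [CommRing R] [IsDomain R] {ξ G L : R} {I : Ideal R}
    (h : Ideal.span {ξ * G} = I * Ideal.span {L}) (hI : I ≠ ⊥) (hL : L ≠ 0) : G ≠ 0 := by
  rintro rfl
  rw [mul_zero, Ideal.span_singleton_eq_bot.mpr rfl, eq_comm, Ideal.mul_eq_bot] at h
  rcases h with h | h
  · exact hI h
  · exact hL (Ideal.span_singleton_eq_bot.mp h)

/-- **Coordinate clause.** If `γ₁` is canonical (`χ_cyc,K(γ₁) ∈ (1 + p)·μ`) and `γ` is a canonical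
`ℚ`-cyclotomic variable (`IsCyclotomicVariable p γ`), then `χ_cyc,ℚ(γ)·ζ = χ_cyc,K(γ₁)` for some `ζ` of
finite order — the hypothesis of the binder's cyclotomic-line clauses.
[cite: BurungaleSkinnerTianWan2024, §2.3 (𝓛^{∘,cyc}_p(g/L) = 𝓛_γ(g)·𝓛_γ′(g′), p0076 L45–47) — the identification Gal(K^cyc_∞/K) ≅ Gal(ℚ_∞/ℚ), bookkeeping] -/
theorem exists_isOfFinOrder_mul_eq_of_canonical {K : Type} [Field K] [NumberField K]
    {γ₁ : absoluteGaloisGroup K} {γ : absoluteGaloisGroup ℚ}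
    (hcan : ∃ ζ : ℤ_[p]ˣ, IsOfFinOrder ζ ∧
      ((GaloisRep.cyclotomicCharacter K p γ₁ * ζ : ℤ_[p]ˣ) : ℤ_[p]) = (cyclotomicGenerator p : ℤ_[p]))
    (hγ : IsCyclotomicVariable p γ) :
    ∃ ζ : ℤ_[p]ˣ, IsOfFinOrder ζ ∧
      GaloisRep.cyclotomicCharacter ℚ p γ * ζ = GaloisRep.cyclotomicCharacter K p γ₁ := by
  obtain ⟨ζ₀, hζ₀, h0⟩ := hγ
  obtain ⟨ζ₁, hζ₁, h1⟩ := hcan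
  have h01 : GaloisRep.cyclotomicCharacter ℚ p γ * ζ₀ = GaloisRep.cyclotomicCharacter K p γ₁ * ζ₁ :=
    Units.ext (by rw [h0, h1])
  refine ⟨ζ₀ * ζ₁⁻¹, hζ₀.mul hζ₁.inv, ?_⟩
  rw [← mul_assoc, h01, mul_inv_cancel_right]

/-! ## §3. Stub (S3) from the package binder -/

/-- **Stub (S3) `stub_transferDescent` of K2R‴ from the typed BSTW package, for the frame's newforms.**
Granted `props118_27_519_exists_signedTwoVariablePackage_supersingular_PRE` BY NAME: for the K1′/K2R‴ package
data (clauses c1–c21 of `SignedLowerDescentFromCommonFrame`, unpacked), a genuine common frame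
`(Ω ≠ 0, δ² = ±D_K, Ω_p, L_K, G, G')`, a structure map `J`, the s-free product inclusion
`ch(X_Gr(W/K̃_∞))^{ur}·ch(X_Gr(W'/K̃_∞))^{ur} ⊆ (G·G')`, and «`γ₁` canonical»: for all globally minimal
`W₂ ≃ W^{(D_K)}`, `W₄ ≃ W'^{(D_K)}`, every Kobayashi sign `ε`, every canonical `ℚ`-cyclotomic datum
`(κ, γ)`, every Pollack pair of `f`, of any newform `f₂` of `W₂`, of `f'`, of any newform `f₄` of `W₄`, and
all signed Selmer data with characteristic generators `g₁, g₂, g₃, g₄`: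
`L^ε(f)·L^ε(f₂)·L^ε(f')·L^ε(f₄) ∣ g₁·g₂·g₃·g₄` in `ℤ_p⟦T⟧`.
[cite: BurungaleSkinnerTianWan2024, §2.3 proof of Thm. (KoMC_r) (arXiv v2 TeX store p0076 L36–L65), with Prop. 1.18 (p0072), Prop. 2.7 (p0076 L20–33), Prop. 5.19 (p0054–55) (ANNOUNCED; taken as the OPEN binder `props118_27_519_…_PRE`)]
[cite: Kobayashi2003, Thm. 3.2 and (3.4)–(3.6) (p. 7) (the labelling `kobayashiL`)] -/
theorem productLowerDivisibility_of_package
    (hpkg : props118_27_519_exists_signedTwoVariablePackage_supersingular_PRE) :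
    ∀ (W : WeierstrassCurve ℚ) [W.IsElliptic] [W.IsGloballyMinimal] (p : ℕ) [Fact p.Prime], 5 ≤ p →
    ClassX7 W p → Surj W p →
    ∀ (K : Type) [Field K] [NumberField K] (ι : PadicAlgCl p ≃+* ℂ) (v vbar : IsDedekindDomain.HeightOneSpectrum (NumberField.RingOfIntegers K)) (κ₁ κ₂ : Literature.NumberTheory.EllipticCurves.ZpExtension K p) (γ₁ γ₂ : Field.absoluteGaloisGroup K) [Fact (Literature.NumberTheory.EllipticCurves.ZpExtension.IsTopGeneratorPair κ₁ κ₂ γ₁ γ₂)] [NeZero (NumberField.discr K).natAbs] (N : ℕ) [NeZero N] (f : CuspForm (CongruenceSubgroup.Gamma0 N) 2) (d : ℤ) (W' : WeierstrassCurve ℚ) [W'.IsElliptic] [W'.IsGloballyMinimal] (C : WeierstrassCurve.VariableChange ℚ) (N' : ℕ) [NeZero N'] (f' : CuspForm (CongruenceSubgroup.Gamma0 N') 2),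
    (Literature.NumberTheory.EllipticCurves.ModularForms.IsNewformOf W f) →
    ((N : ℤ) = W.conductorNorm ℤ) →
    (Literature.NumberTheory.EllipticCurves.ModularForms.IsNewformOf W' f') →
    ((N' : ℤ) = W'.conductorNorm ℤ) →
    (Squarefree d) →
    (1 < d) →
    (∀ q : ℕ, q.Prime → Literature.NumberTheory.EllipticCurves.BurungaleSkinnerTianWan2024.RamifiedInQuadratic d q → q ≠ p ∧ ¬ q ∣ N ∧ ¬ (q : ℤ) ∣ NumberField.discr K) →
    (C • W' = W.quadraticTwist (d : ℚ)) →
    (Literature.NumberTheory.EllipticCurves.IsImaginaryQuadratic K) →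
    (((Ideal.span {(p : ℤ)}).primesOver (NumberField.RingOfIntegers K)).ncard = 2) →
    (((p : ℕ) : NumberField.RingOfIntegers K) ∈ v.asIdeal) →
    (((p : ℕ) : NumberField.RingOfIntegers K) ∈ vbar.asIdeal) →
    (vbar ≠ v) →
    (∀ (w : NumberField.InfinitePlace K) (k : NumberField.RingOfIntegers K), k ∈ v.asIdeal ↔ ‖ι.symm (w.embedding (k : K))‖ < 1) →
    (IsCoprime (N : ℤ) (NumberField.discr K)) →
    (∀ ℓ : ℕ, ℓ.Prime → ℓ ∣ N → ((Ideal.span {(ℓ : ℤ)}).primesOver (NumberField.RingOfIntegers K)).ncard = 2) →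
    (∀ ℓ : ℕ, ℓ.Prime → (ℓ : ℤ) ∣ d → ((Ideal.span {(ℓ : ℤ)}).primesOver (NumberField.RingOfIntegers K)).ncard = 2) →
    (((Ideal.span {(2 : ℤ)}).primesOver (NumberField.RingOfIntegers K)).ncard = 2) →
    (∀ ρ : Literature.NumberTheory.GaloisRepresentations.ModPGaloisRep K (ZMod p) 2, (W.baseChange K).IsTorsionGaloisRep p ρ → Literature.NumberTheory.GaloisRepresentations.FramedRep.IsAbsolutelyIrreducible ρ) →
    (κ₁.IsCyclotomic) →
    (κ₂.IsAnticyclotomic) →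
    ∀ (Ω δ : ℂ) (Ωp : (Literature.NumberTheory.EllipticCurves.unrIntegers p)ˣ)
      (LK G G' : PowerSeries (PowerSeries (PadicComplexInt p))),
      Ω ≠ 0 → (δ ^ 2 = (NumberField.discr K : ℂ) ∨ δ ^ 2 = -(NumberField.discr K : ℂ)) →
      Literature.NumberTheory.EllipticCurves.IsKatzMeasure₂ ι v vbar ∅ κ₁ κ₂ γ₁⁻¹ γ₂⁻¹ 1 Ω δ
        ((Ωp : Literature.NumberTheory.EllipticCurves.unrIntegers p) : PadicComplex p) LK →
      Literature.NumberTheory.EllipticCurves.IsGreenbergLFunctionAnyRoot₂ ι v vbar κ₁ κ₂ γ₁⁻¹ γ₂⁻¹ f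
        (NumberField.discr K).natAbs (NumberField.classNumber K) LK G →
      Literature.NumberTheory.EllipticCurves.IsGreenbergLFunctionAnyRoot₂ ι v vbar κ₁ κ₂ γ₁⁻¹ γ₂⁻¹ f'
        (NumberField.discr K).natAbs (NumberField.classNumber K) LK G' →
    ∀ J : ℤ_[p] →+* PadicComplexInt p,
      (∀ x : ℤ_[p], ((J x : PadicComplexInt p) : PadicComplex p) = ((x : ℚ_[p]) : PadicComplex p)) →
      (WeierstrassCurve.XGr₂.charIdeal (W.baseChange K) p κ₁ κ₂ vbar γ₁ γ₂).map
          (Literature.NumberTheory.EllipticCurves.IwasawaAlgebra₂.toUnr₂ p J) *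
        (WeierstrassCurve.XGr₂.charIdeal (W'.baseChange K) p κ₁ κ₂ vbar γ₁ γ₂).map
          (Literature.NumberTheory.EllipticCurves.IwasawaAlgebra₂.toUnr₂ p J) ≤ Ideal.span {G * G'} →
    -- «γ₁ canonical» (NOT in the package as filed)
    (∃ ζ : ℤ_[p]ˣ, IsOfFinOrder ζ ∧
      ((GaloisRep.cyclotomicCharacter K p γ₁ * ζ : ℤ_[p]ˣ) : ℤ_[p]) = (cyclotomicGenerator p : ℤ_[p])) →
    ∀ (W₂ W₄ : WeierstrassCurve ℚ) [W₂.IsElliptic] [W₂.IsGloballyMinimal] [W₄.IsElliptic] [W₄.IsGloballyMinimal]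
      (C₂ C₄ : WeierstrassCurve.VariableChange ℚ),
      C₂ • W₂ = W.quadraticTwist (NumberField.discr K : ℚ) → C₄ • W₄ = W'.quadraticTwist (NumberField.discr K : ℚ) →
    ∀ ε : ℤˣ, ∀ (κ : ZpExtension ℚ p) (γ : Field.absoluteGaloisGroup ℚ),
      κ.IsCyclotomic → κ.IsTopGenerator γ → IsCyclotomicVariable p γ →
      ∀ (Lp₁ Lm₁ : IwasawaAlgebra p), IsPollackPair f p Lp₁ Lm₁ →
      ∀ (D₁ : SignedSelmerDualData W κ γ ε) (g₁ : IwasawaAlgebra p), D₁.charIdeal = Ideal.span {g₁} →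
      ∀ {N₂ : ℕ} [NeZero N₂] (f₂ : CuspForm (Gamma0 N₂) 2), IsNewformOf W₂ f₂ →
      ∀ (Lp₂ Lm₂ : IwasawaAlgebra p), IsPollackPair f₂ p Lp₂ Lm₂ →
      ∀ (D₂ : SignedSelmerDualData W₂ κ γ ε) (g₂ : IwasawaAlgebra p), D₂.charIdeal = Ideal.span {g₂} →
      ∀ (Lp₃ Lm₃ : IwasawaAlgebra p), IsPollackPair f' p Lp₃ Lm₃ →
      ∀ (D₃ : SignedSelmerDualData W' κ γ ε) (g₃ : IwasawaAlgebra p), D₃.charIdeal = Ideal.span {g₃} →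
      ∀ {N₄ : ℕ} [NeZero N₄] (f₄ : CuspForm (Gamma0 N₄) 2), IsNewformOf W₄ f₄ →
      ∀ (Lp₄ Lm₄ : IwasawaAlgebra p), IsPollackPair f₄ p Lp₄ Lm₄ →
      ∀ (D₄ : SignedSelmerDualData W₄ κ γ ε) (g₄ : IwasawaAlgebra p), D₄.charIdeal = Ideal.span {g₄} →
      kobayashiL ε Lp₁ Lm₁ * kobayashiL ε Lp₂ Lm₂ * kobayashiL ε Lp₃ Lm₃ * kobayashiL ε Lp₄ Lm₄ ∣
        g₁ * g₂ * g₃ * g₄ := by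
  intro W _ _ p _ hp5 hX hs K _ _ ι v vbar κ₁ κ₂ γ₁ γ₂ hpair _ N _ f d W' _ _ C N' _ f'
    c1 c2 c3 c4 c5 c6 c7 c8 c9 c10 c11 c12 c13 c14 c15 c16 c17 c18 c19 c20 c21
    Ω δ Ωp LK G G' hΩ hδ hLK hG hG' J hJ hfree hcan W₂ W₄ _ _ _ _ C₂ C₄ hC₂ hC₄ ε κ γ hκ hγ hγ'
    Lp₁ Lm₁ hPP₁ D₁ g₁ hg₁ N₂ _ f₂ hf₂ Lp₂ Lm₂ hPP₂ D₂ g₂ hg₂ Lp₃ Lm₃ hPP₃ D₃ g₃ hg₃ N₄ _ f₄ hf₄ Lp₄ Lm₄ hPP₄ D₄ g₄ hg₄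
  -- basics at `p` for `W` and for the twist `W'`
  have hpP : p.Prime := Fact.out
  have hp2 : p ≠ 2 := by omega
  have hgood : W.HasGoodReductionAtPrime p := hX.1.1
  have hap : W.frobeniusTrace p = 0 := ClassX7.frobeniusTrace_eq_zero_of_five_le W p hp5 hX
  have hpN : ¬ (p : ℤ) ∣ W.conductorNorm ℤ := fun h ↦
    (W.dvd_conductorNorm_iff_not_hasGoodReductionAtPrime p).mp (by exact_mod_cast h) hgood
  have hpd : ¬ (p : ℤ) ∣ d := fun h ↦ (c7 p hpP (Or.inl h)).1 rfl
  have hp2d : ¬ (p : ℤ) ∣ 2 * d := by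
    intro h
    rcases (Nat.prime_iff_prime_int.mp hpP).dvd_or_dvd h with h2 | hd'
    · have : p ∣ 2 := by exact_mod_cast h2
      exact hp2 ((Nat.prime_dvd_prime_iff_eq hpP Nat.prime_two).mp this)
    · exact hpd hd'
  have hgood' : W'.HasGoodReductionAtPrime p := hasGoodReductionAtPrime_of_smul_eq_quadraticTwist W W' p c8 hp2d hgood
  have hap' : W'.frobeniusTrace p = 0 := by
    rw [frobeniusTrace_of_smul_eq_quadraticTwist W W' p c5 c8 hp2d hgood, hap, mul_zero]
  have hs' : Surj W' p :=
    (Summit.BirchSwinnertonDyer.BirchSwinnertonDyer.Theorems.SignedBaseChangeAuxiliaryCurves.goodSS_surj_of_smul_eq_quadraticTwist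
      W W' p hp2 c5 hpd c8 hgood hap hs).2.2
  have hpN' : ¬ (p : ℤ) ∣ W'.conductorNorm ℤ := fun h ↦
    (W'.dvd_conductorNorm_iff_not_hasGoodReductionAtPrime p).mp (by exact_mod_cast h) hgood'
  have hND' : IsCoprime (N' : ℤ) (NumberField.discr K) :=
    isCoprime_conductorNorm_twist_discr W W' c8 c2 c4 K c9.1 (fun q hq hr ↦ (c7 q hq hr).2.2) c18 c15
  have hirr' : ∀ ρ : ModPGaloisRep K (ZMod p) 2, (W'.baseChange K).IsTorsionGaloisRep p ρ →
      FramedRep.IsAbsolutelyIrreducible ρ := fun ρ hρ ↦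
    Summit.BirchSwinnertonDyer.BirchSwinnertonDyer.Theorems.SignedBaseChangeK1FrameData.irrK_framed_of_surj
      W' p hp2 hs' K c9.1 ρ hρ
  -- the package at `(f, G)` and at `(f', G')`
  obtain ⟨xi, Ls, hP1, hline⟩ := hpkg ι W K v vbar κ₁ κ₂ γ₁ γ₂ f c1 c2 hp2 hpN hap c9 c10 c11 c12 c13 c14
    c15 c19 c20 c21 Ω δ Ωp LK G hΩ hδ hLK hG J hJ ε
  obtain ⟨xi', Ls', hP1', hline'⟩ := hpkg ι W' K v vbar κ₁ κ₂ γ₁ γ₂ f' c3 c4 hp2 hpN' hap' c9 c10 c11 c12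
    c13 c14 hND' hirr' c20 c21 Ω δ Ωp LK G' hΩ hδ hLK hG' J hJ ε
  -- the cyclotomic-line clauses for `(W, W₂)` and for `(W', W₄)`
  have hcoord := exists_isOfFinOrder_mul_eq_of_canonical hcan hγ'
  obtain ⟨hP2, hP3⟩ := hline κ γ hκ hγ hγ' hcoord W₂ C₂ hC₂
  obtain ⟨hP2', hP3'⟩ := hline' κ γ hκ hγ hγ' hcoord W₄ C₄ hC₄
  -- Kobayashi's `L^ε` out of the Pollack pairs
  have hL₁ : IsSignedPAdicLFunction f p ε (kobayashiL ε Lp₁ Lm₁) := hPP₁.isSignedPAdicLFunction_kobayashiL ε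
  have hL₂ : IsSignedPAdicLFunction f₂ p ε (kobayashiL ε Lp₂ Lm₂) := hPP₂.isSignedPAdicLFunction_kobayashiL ε
  have hL₃ : IsSignedPAdicLFunction f' p ε (kobayashiL ε Lp₃ Lm₃) := hPP₃.isSignedPAdicLFunction_kobayashiL ε
  have hL₄ : IsSignedPAdicLFunction f₄ p ε (kobayashiL ε Lp₄ Lm₄) := hPP₄.isSignedPAdicLFunction_kobayashiL ε
  have h2 := hP2 D₁ D₂ g₁ g₂ hg₁ hg₂
  obtain ⟨u, hu, h3⟩ := hP3 f₂ hf₂ _ _ hL₁ hL₂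
  have h2' := hP2' D₃ D₄ g₃ g₄ hg₃ hg₄
  obtain ⟨u', hu', h3'⟩ := hP3' f₄ hf₄ _ _ hL₃ hL₄
  -- `𝓛^∘ ≠ 0`, `𝓛'^∘ ≠ 0` (their cyclotomic images are units times Pollack's non-zero functions), hence `G G' ≠ 0`
  have hJinj : Function.Injective J := structureMap_injective hJ
  have hLL : ∀ {L L' : IwasawaAlgebra p}, L ≠ 0 → L' ≠ 0 → PowerSeries.map J (L * L') ≠ 0 :=
    fun hL hL' ↦ map_structureMap_ne_zero hJ (mul_ne_zero hL hL')
  have hLs : Ls ≠ 0 := by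
    intro h0
    have h := h3
    rw [h0] at h
    have : PowerSeries.map J (kobayashiL ε Lp₁ Lm₁ * kobayashiL ε Lp₂ Lm₂) = 0 := by
      have h' : u * PowerSeries.map J (kobayashiL ε Lp₁ Lm₁ * kobayashiL ε Lp₂ Lm₂) = 0 := by
        rw [← h]; simp [UnrSeries₂.plus]
      exact (hu.mul_right_eq_zero).mp h'
    exact hLL
      (Summit.BirchSwinnertonDyer.BirchSwinnertonDyer.Theorems.SignedBaseChangeEisensteinSqueeze.kobayashiL_ne_zero hPP₁ ε)
      (Summit.BirchSwinnertonDyer.BirchSwinnertonDyer.Theorems.SignedBaseChangeEisensteinSqueeze.kobayashiL_ne_zero hPP₂ ε) this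
  have hLs' : Ls' ≠ 0 := by
    intro h0
    have h := h3'
    rw [h0] at h
    have : PowerSeries.map J (kobayashiL ε Lp₃ Lm₃ * kobayashiL ε Lp₄ Lm₄) = 0 := by
      have h' : u' * PowerSeries.map J (kobayashiL ε Lp₃ Lm₃ * kobayashiL ε Lp₄ Lm₄) = 0 := by
        rw [← h]; simp [UnrSeries₂.plus]
      exact (hu'.mul_right_eq_zero).mp h'
    exact hLL
      (Summit.BirchSwinnertonDyer.BirchSwinnertonDyer.Theorems.SignedBaseChangeEisensteinSqueeze.kobayashiL_ne_zero hPP₃ ε)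
      (Summit.BirchSwinnertonDyer.BirchSwinnertonDyer.Theorems.SignedBaseChangeEisensteinSqueeze.kobayashiL_ne_zero hPP₄ ε) this
  have hG0 : G ≠ 0 := ne_zero_of_span_mul_eq hP1 (map_charIdealXGr₂_ne_bot _ κ₁ κ₂ vbar γ₁ γ₂ hJinj) hLs
  have hG0' : G' ≠ 0 := ne_zero_of_span_mul_eq hP1' (map_charIdealXGr₂_ne_bot _ κ₁ κ₂ vbar γ₁ γ₂ hJinj) hLs'
  have hGG' : G * G' ≠ 0 := mul_ne_zero hG0 hG0'
  -- cancel the Greenberg functions (P1 ×2 + the s-free product inclusion): `𝓛^∘ 𝓛'^∘ ∣ ξ_∘ ξ'_∘`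
  have hdvd : Ls * Ls' ∣ xi * xi' := mul_dvd_mul_of_span_mul_eq_of_le_span hP1 hP1' hfree hGG'
  -- descend through `plus` = "mod (γ_ac − 1)" with (P2), (P3)
  have hS : PowerSeries.map J (kobayashiL ε Lp₁ Lm₁ * kobayashiL ε Lp₂ Lm₂) *
      PowerSeries.map J (kobayashiL ε Lp₃ Lm₃ * kobayashiL ε Lp₄ Lm₄) ∣
      PowerSeries.map J (g₁ * g₂) * PowerSeries.map J (g₃ * g₄) :=
    mul_dvd_mul_of_map_of_dvd_of_eq_unit_mul
      (PowerSeries.map (PowerSeries.constantCoeff (R := PadicComplexInt p))) hdvd h2 h2' hu hu' h3 h3'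
  -- descend to `ℤ_p⟦T⟧`
  rw [← map_mul, ← map_mul] at hS
  have hZ := Summit.BirchSwinnertonDyer.BirchSwinnertonDyer.Theorems.SignedBaseChangeK2RDivisibilityDescent.iwasawaAlgebra_dvd_of_map_dvd_map_padicComplexInt
    hJ hS
  have e1 : kobayashiL ε Lp₁ Lm₁ * kobayashiL ε Lp₂ Lm₂ * kobayashiL ε Lp₃ Lm₃ * kobayashiL ε Lp₄ Lm₄ =
      kobayashiL ε Lp₁ Lm₁ * kobayashiL ε Lp₂ Lm₂ * (kobayashiL ε Lp₃ Lm₃ * kobayashiL ε Lp₄ Lm₄) := by ring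
  have e2 : g₁ * g₂ * g₃ * g₄ = g₁ * g₂ * (g₃ * g₄) := by ring
  rw [e1, e2]
  exact hZ

end Summit.BirchSwinnertonDyer.BirchSwinnertonDyer.Theorems.SignedBaseChangeK2RTransferDescent

end
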